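import Mathlib.Topology.Algebra.OpenSubgroup
import Mathlib.GroupTheory.Index
import Literature.RepresentationTheory.CharacterSelfExtensionModel
import HarnessLib

/-!
# Locally constant additive maps vanish on compact subgroups; smooth additive characters of a `ℤ`-by-compact group form one line

Generic topological-group algebra, Mathlib + the tree's `CharacterSelfExtensionModel` (for the last step only), THEOREMS ONLY
(no `def`, no instance, no named fact).

THE SITUATION.  `Λ : G → V` an ADDITIVE map on a group (`Λ (g h) = Λ g + Λ h`) with values in an additive group `V` WITHOUT TORSION
(`n • v = 0 ⇒ v = 0` for `n ≠ 0`; automatic for vector spaces in characteristic `0`, `torsionFree_of_charZero`).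

* §1 FINITE INDEX (no topology): if `Λ` vanishes on a NORMAL subgroup of FINITE INDEX then `Λ = 0` (`g ^ [G:N] ∈ N`, so
  `[G:N] • Λ g = 0`).
* §2 COMPACT GROUPS: if `G` is compact and `Λ` vanishes on an OPEN subgroup `U` then `Λ = 0` (the kernel `{Λ = 0}` is a normal
  subgroup containing `U`, hence open, hence of finite index by Mathlib `Subgroup.quotient_finite_of_isOpen`); relative form for a
  compact SUBGROUP `C ≤ G` and an open `U` (`eq_zero_on_compact_of_eq_zero_on_open`).
* §3 ONE LINE: if moreover `G` is generated by `C` and one element `t₀`, and `ord : G → ℤ` is additive with `ord|_C = 0`, `ord t₀ = 1`,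
  then `Λ g = ord g • Λ t₀` (★ `additive_eq_zsmul_of_closure_insert`): the additive maps killed by an open subgroup of the compact part —
  the «smooth additive characters» — of a `ℤ`-by-compact group form ONE line, spanned by `ord`.

USE (consumer-in-waiting): `G = T = E_w^× × E_w^1` a `p`-adic torus, `C = T_c` its maximal compact subgroup, `t₀ = d(ϖ, 1, ϖ̄⁻¹)`, `ord = ord_w`:
the additive character `Λ_E` of a SMOOTH self-extension of a character of `T` (★ `CharacterSelfExtensionModel`) vanishes on the open
stabiliser of its two basis vectors, hence on `T_c`, hence `Λ_E = Λ_E(t₀) · ord_w` — «`Ext¹_smooth(χ, χ)` is a line».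

SOURCES (what is formalised, read at our letters).  K. S. Brown, *Cohomology of Groups*, Ch. III §1 Exercise 2 p. 60 («`H¹(G, M) ≈
Hom(G, M) = Hom(G_ab, M)`» for trivial `M`) — read: an additive map factors through every quotient by a subgroup it kills, here a
FINITE quotient (finite index, resp. compact-by-open), and a homomorphism from a finite group to a torsion-free group is trivial; and
N. Bourbaki, *General Topology* Ch. III §2 no. 1 (open subgroups of a topological group are closed; in a compact group an open subgroup
has finite index — Mathlib `Subgroup.quotient_finite_of_isOpen`) [BourbakiGT1, Ch. III §2 no. 1].  Deliberately NOT here: continuity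
of `Λ` beyond «vanishes on an open subgroup», Pontryagin duality, and anything about the specific torus.
-/

set_option autoImplicit false

namespace Literature.Topology.Algebra

variable {G : Type*} [Group G] {V : Type*} [AddCommGroup V]

/-! ## §1 Finite index: an additive map killing a normal subgroup of finite index is zero on a torsion-free target -/

/-- An additive map on a group sends `1 ↦ 0`. [cite: Brown1982, Ch. III §1 Exercise 2 p. 60] -/
theorem additive_map_one (Λ : G → V) (hΛ : ∀ g h, Λ (g * h) = Λ g + Λ h) : Λ 1 = 0 := by
  have h := hΛ 1 1
  rw [mul_one] at h
  exact left_eq_add.mp h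

/-- An additive map on a group sends powers to multiples: `Λ (g ^ n) = n • Λ g`. [cite: Brown1982, Ch. III §1 Exercise 2 p. 60] -/
theorem additive_map_pow (Λ : G → V) (hΛ : ∀ g h, Λ (g * h) = Λ g + Λ h) (g : G) (n : ℕ) : Λ (g ^ n) = n • Λ g := by
  induction n with
  | zero => rw [pow_zero, zero_smul, additive_map_one Λ hΛ]
  | succ n ih => rw [pow_succ, hΛ, ih, succ_nsmul]

/-- **FINITE-INDEX VANISHING.**  If `Λ` is additive, vanishes on a normal subgroup `N` of finite index, and `V` has no `[G:N]`-torsion,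
then `Λ = 0`: `g ^ [G:N] ∈ N` (Mathlib `Subgroup.pow_index_mem`) gives `[G:N] • Λ g = 0`. [cite: Brown1982, Ch. III §1 Exercise 2 p. 60] -/
theorem eq_zero_of_eq_zero_on_finiteIndex (Λ : G → V) (hΛ : ∀ g h, Λ (g * h) = Λ g + Λ h) (N : Subgroup G) [N.Normal]
    [N.FiniteIndex] (hN : ∀ n ∈ N, Λ n = 0) (htf : ∀ v : V, N.index • v = 0 → v = 0) (g : G) : Λ g = 0 := by
  apply htf
  rw [← additive_map_pow Λ hΛ]
  exact hN _ (Subgroup.pow_index_mem N g)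

/-- The kernel `{g | Λ g = 0}` of an additive map into an ABELIAN group is a NORMAL subgroup; packaged as: for any subgroup `U` on
which `Λ` vanishes, `Λ` vanishes on the normal closure of `U`. [cite: Brown1982, Ch. III §1 Exercise 2 p. 60] -/
theorem eq_zero_on_normalClosure (Λ : G → V) (hΛ : ∀ g h, Λ (g * h) = Λ g + Λ h) (U : Subgroup G) (hU : ∀ u ∈ U, Λ u = 0)
    (g : G) (hg : g ∈ Subgroup.normalClosure (U : Set G)) : Λ g = 0 := by
  have h1 : Λ 1 = 0 := additive_map_one Λ hΛ
  have hinv : ∀ x, Λ x⁻¹ = -Λ x := fun x => by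
    have h := hΛ x⁻¹ x
    rw [inv_mul_cancel, h1] at h
    exact (neg_eq_of_add_eq_zero_left h.symm).symm
  -- the kernel as a normal subgroup
  let K : Subgroup G :=
    { carrier := {x | Λ x = 0}
      mul_mem' := fun {a b} ha hb => by
        simp only [Set.mem_setOf_eq] at ha hb ⊢
        rw [hΛ, ha, hb, add_zero]
      one_mem' := h1
      inv_mem' := fun {a} ha => by
        simp only [Set.mem_setOf_eq] at ha ⊢
        rw [hinv, ha, neg_zero] }
  have hKn : K.Normal := ⟨fun a ha b => by
    change Λ (b * a * b⁻¹) = 0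
    change Λ a = 0 at ha
    rw [hΛ, hΛ, ha, hinv, add_zero, add_neg_cancel]⟩
  have hle : Subgroup.normalClosure (U : Set G) ≤ K := Subgroup.normalClosure_le_normal (fun u hu => hU u hu)
  exact hle hg

/-! ## §2 Compact groups: an additive map killing an open subgroup is zero on a torsion-free target -/

section Compact

variable [TopologicalSpace G] [IsTopologicalGroup G]

/-- **COMPACT-OPEN VANISHING.**  On a COMPACT group, an additive map into a torsion-free abelian group that vanishes on an OPEN subgroup
vanishes identically: the normal closure of the open subgroup is an open normal subgroup, of finite index by compactness (Mathlib
`Subgroup.quotient_finite_of_isOpen`), and §1 applies. [cite: BourbakiGT1, Ch. III §2 no. 1] [cite: Brown1982, Ch. III §1 Exercise 2 p. 60] -/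
theorem eq_zero_of_eq_zero_on_open [CompactSpace G] (Λ : G → V) (hΛ : ∀ g h, Λ (g * h) = Λ g + Λ h) (U : Subgroup G)
    (hUo : IsOpen (U : Set G)) (hU : ∀ u ∈ U, Λ u = 0) (htf : ∀ (n : ℕ) (v : V), n ≠ 0 → n • v = 0 → v = 0) (g : G) :
    Λ g = 0 := by
  set N := Subgroup.normalClosure (U : Set G) with hNdef
  haveI : N.Normal := Subgroup.normalClosure_normal
  have hNo : IsOpen (N : Set G) :=
    Subgroup.isOpen_mono (Subgroup.subset_normalClosure) hUo
  haveI : Finite (G ⧸ N) := Subgroup.quotient_finite_of_isOpen N hNo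
  haveI : N.FiniteIndex := Subgroup.finiteIndex_of_finite_quotient
  exact eq_zero_of_eq_zero_on_finiteIndex Λ hΛ N (eq_zero_on_normalClosure Λ hΛ U hU)
    (fun v hv => htf N.index v Subgroup.FiniteIndex.index_ne_zero hv) g

/-- **RELATIVE FORM: VANISHING ON A COMPACT SUBGROUP.**  If `Λ` is additive on `G`, `C ≤ G` is a compact subgroup, `U` is a subgroup
open in `G` on which `Λ` vanishes (so `Λ` vanishes on the open subgroup `U ⊓ C` of `C`), and `V` is torsion-free, then `Λ` vanishes
on `C`. [cite: BourbakiGT1, Ch. III §2 no. 1]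
[cite: Brown1982, Ch. III §1 Exercise 2 p. 60] -/
theorem eq_zero_on_compact_of_eq_zero_on_open (Λ : G → V) (hΛ : ∀ g h, Λ (g * h) = Λ g + Λ h) (C : Subgroup G)
    (hC : IsCompact (C : Set G)) (U : Subgroup G) (hUo : IsOpen (U : Set G)) (hU : ∀ u ∈ U, Λ u = 0)
    (htf : ∀ (n : ℕ) (v : V), n ≠ 0 → n • v = 0 → v = 0) (c : G) (hc : c ∈ C) : Λ c = 0 := by
  haveI : CompactSpace C := isCompact_iff_compactSpace.mp hC
  -- restrict everything to the compact group `C`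
  have hΛC : ∀ g h : C, (fun x : C => Λ x) (g * h) = (fun x : C => Λ x) g + (fun x : C => Λ x) h :=
    fun g h => hΛ g h
  have hUo' : IsOpen ((U.subgroupOf C : Subgroup C) : Set C) := by
    have : ((U.subgroupOf C : Subgroup C) : Set C) = ((↑) : C → G) ⁻¹' (U : Set G) := rfl
    rw [this]
    exact hUo.preimage continuous_subtype_val
  have hU' : ∀ u ∈ U.subgroupOf C, (fun x : C => Λ x) u = 0 := fun u hu => hU u (Subgroup.mem_subgroupOf.mp hu)
  exact eq_zero_of_eq_zero_on_open (fun x : C => Λ x) hΛC (U.subgroupOf C) hUo' hU' htf ⟨c, hc⟩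

end Compact

/-! ## §3 One line: `Λ = Λ(t₀) · ord` for a `ℤ`-by-compact group -/

section OneLine

variable [TopologicalSpace G] [IsTopologicalGroup G]

/-- **SMOOTH ADDITIVE CHARACTERS OF A `ℤ`-BY-COMPACT GROUP FORM ONE LINE.**  Let `C ≤ G` be a compact subgroup and `t₀ ∈ G` with
`G` generated by `C ∪ {t₀}`; let `ord : G → ℤ` be additive with `ord|_C = 0` and `ord t₀ = 1`.  Then every additive `Λ : G → V` into a
torsion-free abelian group that vanishes on some subgroup `U` open in `G` satisfies `Λ g = ord g • Λ t₀` for all `g` (§2 + the tree's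
`additive_eq_zsmul_of_closure_insert`).  For a `p`-adic torus `T = T_c · t₀^ℤ` this is «`Hom_smooth(T, V) = V · ord_w`».
[cite: Brown1982, Ch. III §1 Exercise 2 p. 60] [cite: BourbakiGT1, Ch. III §2 no. 1] -/
theorem additive_eq_zsmul_of_eq_zero_on_open (Λ : G → V) (hΛ : ∀ g h, Λ (g * h) = Λ g + Λ h) (C : Subgroup G)
    (hC : IsCompact (C : Set G)) {t₀ : G} (hgen : Subgroup.closure (insert t₀ (C : Set G)) = ⊤) (U : Subgroup G)
    (hUo : IsOpen (U : Set G)) (hU : ∀ u ∈ U, Λ u = 0) (htf : ∀ (n : ℕ) (v : V), n ≠ 0 → n • v = 0 → v = 0)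
    (ord : G → ℤ) (hord : ∀ g h, ord (g * h) = ord g + ord h) (hordC : ∀ c ∈ C, ord c = 0) (hordt : ord t₀ = 1) (g : G) :
    Λ g = ord g • Λ t₀ :=
  Literature.RepresentationTheory.additive_eq_zsmul_of_closure_insert Λ hΛ ord hord hgen
    (fun c hc => eq_zero_on_compact_of_eq_zero_on_open Λ hΛ C hC U hUo hU htf c hc) hordC hordt g

end OneLine

/-! ## §4 Torsion-freeness of vector spaces in characteristic zero -/

/-- In a module over a division ring of characteristic `0`, `n • v = 0` with `n ≠ 0` forces `v = 0` — the torsion-freeness hypothesis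
`htf` of §§1–3 for the usual coefficient spaces. [cite: Brown1982, Ch. III §1 Exercise 2 p. 60] -/
theorem torsionFree_of_charZero {k : Type*} [DivisionRing k] [CharZero k] {W : Type*} [AddCommGroup W] [Module k W]
    (n : ℕ) (w : W) (hn : n ≠ 0) (h : n • w = 0) : w = 0 := by
  rw [← Nat.cast_smul_eq_nsmul k, smul_eq_zero] at h
  rcases h with h | h
  · exact absurd (Nat.cast_eq_zero.mp h) hn
  · exact h

end Literature.Topology.Algebra
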